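import Literature.MathematicalPhysics.QuantumFieldTheory.Balaban1983to89.T4StairWordSystemCubeTreeInduction

/-!
# `Balaban1983to89.T4StairWordSystemCubeTreeProp1` — THE TREE-OF-BOXES NORMALISER AT THE OBJECTS OF [15] PROPOSITION 1: the letter `hgauge` for a component whose region is a
# TREE OF BOXES rooted at the big box, with the word function hidden (turnkey capstone of `T4StairWordSystemCubeTree{,Glue,Induction}`)

Cell `pub-ymgap` (Track A DAG, node N12 = [B15] = T. Bałaban, *Large field renormalization. I*, Commun. Math. Phys. **122** (1989) 175–202 [Balaban1989LargeFieldI]),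
width seat `dag-n12-w2` (g5), piece (R1) (lane words dag-n12-c g19, cell bus l.37564 ∕ l.37914 ∕ LOCATED-GEOM v3 (3) l.38396; scope line of record (a): components whose
`Ω₁(Z)` is simply connected and normalisable on the region — boxes (dag-n12-w6 §7) and TREES OF BOXES (this lineage)).  Count-neutral Literature helper.  HONEST FRAMING: a
composition BY NAME of `exists_treeWords` + `treeOfBoxes_bondBound` (file III) + `walk_stairWord_mem_box` (file I) + `exists_gauge_normalising_extend_of_bondBoundSystem_le`
(file II) over dag-n12-w6's extension ∕ shell-gauge lemmas; lattice ∕ gauge bookkeeping on the tree's own objects; nothing of Bałaban's estimates ((1.7) ∕ (2.14) plaquette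
smallness, [15] Thm 1, Proposition 1, the datum side) is asserted; N12 is NOT discharged by this file; one finite `𝕋⁴` programme at fixed `ε`; nothing here bears on the
continuum ∕ OS ∕ mass-gap statement.

THE STATEMENT (p. 194, the sentence after (1.77): *«The function is invariant with respect to the group of all gauge transformations defined on Λ, hence it is natural to
consider it on orbits of this group»*).  INPUTS: the objects of Proposition 1 exactly as in `T4WordSystemGaugeBound` §5 (`d ≥ 3`; the small-field box `Λ^{(k)} = castSite '' [lo, hi]`
of side `≤ n + 1`, non-wrapping; its big box's plaquettes inside `Z^{(k)}`; `V` with `ε`-small plaquettes on `Z ∩ Λᶜ`); a TREE OF BOXES `Q_i = castSite '' [A i, B i]` with `Q_0` = the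
big box `[lo − 1, hi + 1]` rooted at a point `c` of it, uniform size `m`, pairwise disjoint, box `i ≥ 1` attached to `p i < i` through `f i ∈ Q_{p i} ∩ [A i − 1, B i + 1]` with
separation in the first axis `μ i` of its order `σ i`, touching `⋃_{k<i} Q_k` only through `Q_{p i}`; and the located plaquette boxes of files I–III inside `Z^{(k)}` (general form, or —
`_central` — ONE box `[A i − 2, B i + 4]` per box when `c` and the entries are near-central transversally).  OUTPUT = the letter `hgauge` VERBATIM:
`∃ u, (∀ s ∈ Λ^{(k)}, u s = 1) ∧ u (castSite (lo − 1)) = 1 ∧ ∀ b ∈ 𝒞, dist1 ((Ṽ_k)^u b) ≤ ρ` for every bond set `𝒞` with both ends in `⋃_{i<N} Q_i` and every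
`ρ ≥ max K_box(m) K_cross(m) · (12d(n+2)² + 1)ε + (d(m+1) + 1)·3d(n+2)²ε`.

WHAT IS PROVED (no `def`, no `sorry`; `G` any `GaugeGroup`): ★★★ `exists_gauge_normalising_extend_of_boxTree_le`, ★★★ `exists_gauge_normalising_extend_of_boxTree_central_le`.
HONEST SCOPE (LOCATED-GEOM v2 ∕ v3 unchanged): trees of boxes only; ring-shaped `Ω₁(Z)` stay vacuous-by-shape (dag-n12-c's `B15Prop1HolonomyObstruction`); that the located boxes lie
in `Z^{(k)}` is the caller's collar inclusion ([Balaban1989LargeFieldIII] (2.1)–(2.2)), displayed.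

References: T. Bałaban, CMP 122 (1989) 175–202 [Balaban1989LargeFieldI] (p.193, p.194); CMP 98 (1985) 17–51 [Balaban1985Averaging] ((8)–(9) p.19, (19)–(20) p.21);
CMP 109 (1987) 249–301 [Balaban1987RG1] ((0.3) p.252).
-/

noncomputable section

open Set

namespace Literature.MathematicalPhysics.QuantumFieldTheory.Balaban1983to89.T4StairWordSystemCubeTreeProp1

open T4Continuum T4ReflectionCone B15DeterminingSets
open T4AxialGaugeSmallField (castSite boxPlaqs)
open B15Prop1Carrier (plaqsInside)
open B15Extension193 (extend)
open B15ShellGauge193 (shellGauge)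
open T4StairWordPrefix (stairWordSystem_box)
open T4StairWordSystemCubeTree (walk_stairWord_mem_box)
open T4StairWordSystemCubeTreeGlue (exists_gauge_normalising_extend_of_bondBoundSystem_le)
open T4StairWordSystemCubeTreeInduction (exists_treeWords treeOfBoxes_bondBound sharpBox_subset_of_central crossBox_subset_of_central)

variable {P : Params} {k : ℕ} {G : Type*} [GaugeGroup G] {lo hi : Fin P.d → ℤ}

/-- ★★★ **THE LETTER `hgauge` FOR A TREE-OF-BOXES COMPONENT** (general located boxes).  See the file header for the inputs; the word function of the tree is constructed inside
(`exists_treeWords`), (INV) along the tree for every configuration with `(12d(n+2)²+1)ε`-small plaquettes on `Z^{(k)}` is `treeOfBoxes_bondBound` (iii), the big-box letters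
`hℓ`∕`hin` of file II §4 are `stairWordSystem_box` (ii) ∕ `walk_stairWord_mem_box`, and the conclusion is `exists_gauge_normalising_extend_of_bondBoundSystem_le`.
[cite: Balaban1989LargeFieldI, p.193, p.194 (sentence after (1.77)); Balaban1985Averaging, (8)-(9) p.19 and (19)-(20) p.21; Balaban1987RG1, (0.3) p.252] -/
theorem exists_gauge_normalising_extend_of_boxTree_le (hd : 3 ≤ P.d) (hlohi : lo ≤ hi) {n : ℕ}
    (hn : ∀ κ, hi κ ≤ lo κ + n) (hN : ∀ κ, hi κ - lo κ + 3 < (P.sitesPerDir k : ℤ)) {Z Λ : Set (Site P 0)}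
    (hbox : pts k Λ = (castSite '' Set.Icc lo hi : Set (Site P k)))
    (hZ : (boxPlaqs (lo - 1) (hi + 1) : Set (Plaq P k)) ⊆ plaqsInside (pts k Z))
    {ε : ℝ} (hε : 0 < ε) {V : GaugeField P k G} (hreg : PlaqSmallOn (plaqsInside (pts k (Z ∩ Λᶜ))) ε V)
    (A B : ℕ → Fin P.d → ℤ) (hA0 : A 0 = lo - 1) (hB0 : B 0 = hi + 1)
    {m : ℕ} (hm : ∀ i κ, B i κ ≤ A i κ + m) (hNi : ∀ i κ, B i κ - A i κ + 3 < (P.sitesPerDir k : ℤ))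
    (hmN : 2 * (P.d * (m + 1) + 1) + 1 < P.sitesPerDir k)
    (rep : ℕ → Site P k → Fin P.d → ℤ)
    (hrep : ∀ i, ∀ x ∈ (castSite '' Set.Icc (A i) (B i) : Set (Site P k)), A i ≤ rep i x ∧ rep i x ≤ B i ∧ (castSite (rep i x) : Site P k) = x)
    (σ : ℕ → Equiv.Perm (Fin P.d)) (μ : ℕ → Fin P.d) (hσ : ∀ i, ∃ rest, (List.finRange P.d).map (σ i) = μ i :: rest)
    {c : Fin P.d → ℤ} (hcA : A 0 ≤ c) (hcB : c ≤ B 0)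
    (hS0 : (boxPlaqs (fun κ => (if κ = μ 0 then A 0 κ else min (A 0 κ) (2 * c κ - B 0 κ)) - 1)
              (fun κ => (if κ = μ 0 then B 0 κ else max (B 0 κ) (2 * c κ - A 0 κ)) + 3) : Set (Plaq P k)) ⊆ plaqsInside (pts k Z))
    (p : ℕ → ℕ) (hp : ∀ i, 1 ≤ i → p i < i) (f : ℕ → Fin P.d → ℤ)
    (hfA : ∀ i, 1 ≤ i → A (p i) ≤ f i) (hfB : ∀ i, 1 ≤ i → f i ≤ B (p i))
    (hfA' : ∀ i, 1 ≤ i → A i - 1 ≤ f i) (hfB' : ∀ i, 1 ≤ i → f i ≤ B i + 1)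
    (hNN : ∀ i, 1 ≤ i → ∀ κ, max (B (p i) κ) (B i κ) + 1 - min (A (p i) κ) (A i κ) < (P.sitesPerDir k : ℤ))
    (hsep : ∀ i, 1 ≤ i → B (p i) (μ i) < A i (μ i) ∨ B i (μ i) < A (p i) (μ i))
    (hdisj : ∀ i i', i ≠ i' → Disjoint (castSite '' Set.Icc (A i) (B i) : Set (Site P k)) (castSite '' Set.Icc (A i') (B i')))
    (htouch : ∀ i, 1 ≤ i → ∀ (s : Site P k) (ν : Fin P.d), (s ∈ ⋃ k' < i, (castSite '' Set.Icc (A k') (B k') : Set (Site P k))) →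
      s.shift ν ∈ (castSite '' Set.Icc (A i) (B i) : Set (Site P k)) → s ∈ (castSite '' Set.Icc (A (p i)) (B (p i)) : Set (Site P k)))
    (htouch' : ∀ i, 1 ≤ i → ∀ (s : Site P k) (ν : Fin P.d), s ∈ (castSite '' Set.Icc (A i) (B i) : Set (Site P k)) →
      (s.shift ν ∈ ⋃ k' < i, (castSite '' Set.Icc (A k') (B k') : Set (Site P k))) → s.shift ν ∈ (castSite '' Set.Icc (A (p i)) (B (p i)) : Set (Site P k)))
    (hSin : ∀ i, 1 ≤ i → (boxPlaqs (fun κ => (if κ = μ i then A i κ else min (A i κ) (2 * f i κ - B i κ)) - 1)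
              (fun κ => (if κ = μ i then B i κ else max (B i κ) (2 * f i κ - A i κ)) + 3) : Set (Plaq P k)) ⊆ plaqsInside (pts k Z))
    (hScross : ∀ i, 1 ≤ i → (boxPlaqs (fun κ => if κ = μ i then f i (μ i) - 1 else min (A (p i) κ) (2 * f i κ - B (p i) κ))
              (fun κ => if κ = μ i then f i (μ i) + 3 else max (B (p i) κ) (2 * f i κ - A (p i) κ) + 2) : Set (Plaq P k)) ⊆ plaqsInside (pts k Z))
    (N : ℕ) (𝒞 : Set (PBond P k))
    (h𝒞 : ∀ b ∈ 𝒞, (b.src ∈ ⋃ i < N, (castSite '' Set.Icc (A i) (B i) : Set (Site P k))) ∧ (b.tgt ∈ ⋃ i < N, (castSite '' Set.Icc (A i) (B i) : Set (Site P k))))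
    {ρ : ℝ}
    (hρ : max ((((2 * (P.d * (m + 1) + 1) + 1 : ℕ) : ℝ) ^ 2 / 4))
              (((P.d * (max m m + 1) : ℕ) : ℝ) * ((((2 * (P.d * (m + 1) + 1) + 1 : ℕ) : ℝ) ^ 2 / 4))
                + ((2 * (P.d * (max m m + 1)) + 1 : ℕ) : ℝ) ^ 2 / 4) * ((12 * P.d * (n + 2) ^ 2 + 1) * ε)
          + (((P.d * (m + 1) : ℕ) : ℝ) + 1) * (3 * P.d * (n + 2) ^ 2 * ε) ≤ ρ) :
    ∃ u : GaugeTransf P k G, (∀ s ∈ pts k Λ, u s = 1) ∧ u (castSite (lo - 1)) = 1 ∧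
      ∀ b ∈ 𝒞, dist1 (GaugeField.gaugeAct u (extend (pts k Λ) (shellGauge V lo hi) V) b) ≤ ρ := by
  -- the tree's word function
  have hfQ : ∀ i, 1 ≤ i → (castSite (f i) : Site P k) ∈ (castSite '' Set.Icc (A (p i)) (B (p i)) : Set (Site P k)) :=
    fun i hi => ⟨f i, ⟨hfA i hi, hfB i hi⟩, rfl⟩
  obtain ⟨W, hW0, hWi⟩ := exists_treeWords A B rep σ ([] : List (Letter P.d)) c p hp f hfQ hdisj
  have hhA : A 0 - 1 ≤ c := fun κ => by have := hcA κ; rw [Pi.sub_apply, Pi.one_apply]; linarith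
  have hhB : c ≤ B 0 + 1 := fun κ => by have := hcB κ; rw [Pi.add_apply, Pi.one_apply]; linarith
  have hρ0 : walkEnd (castSite c : Site P k) [] = castSite c := rfl
  have hbig : (castSite '' Set.Icc (lo - 1) (hi + 1) : Set (Site P k)) = castSite '' Set.Icc (A 0) (B 0) := by rw [hA0, hB0]
  -- the big-box letters `hℓ`, `hin` of the root's stair words
  obtain ⟨-, hlen0, -⟩ := stairWordSystem_box.{0} (σ 0) hhA hhB (hNi 0) (hm 0) (rep 0) (hrep 0)
  have hℓ : ∀ x ∈ (castSite '' Set.Icc (lo - 1) (hi + 1) : Set (Site P k)), (W x).length ≤ P.d * (m + 1) := fun x hx => by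
    rw [hbig] at hx
    rw [hW0 x hx, List.nil_append]
    exact hlen0 x hx
  have hin : ∀ x ∈ (castSite '' Set.Icc (lo - 1) (hi + 1) : Set (Site P k)), ∀ st ∈ walk (castSite c : Site P k) (W x),
      st.bond.src ∈ (castSite '' Set.Icc (lo - 1) (hi + 1) : Set (Site P k)) ∧
        st.bond.tgt ∈ (castSite '' Set.Icc (lo - 1) (hi + 1) : Set (Site P k)) := fun x hx st hst => by
    rw [hbig] at hx ⊢
    rw [hW0 x hx, List.nil_append] at hst
    exact walk_stairWord_mem_box (σ 0) hcA hcB (hrep 0 x hx).1 (hrep 0 x hx).2.1 st hst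
  -- (INV) along the tree for every configuration with small plaquettes on `Z^{(k)}`
  have hε' : (0 : ℝ) ≤ (12 * P.d * (n + 2) ^ 2 + 1) * ε := by positivity
  have hinv : ∀ U' : GaugeField P k G, PlaqSmallOn (plaqsInside (pts k Z)) ((12 * P.d * (n + 2) ^ 2 + 1) * ε) U' →
      ∀ (s : Site P k) (ν : Fin P.d), (s ∈ ⋃ i < N, (castSite '' Set.Icc (A i) (B i) : Set (Site P k))) →
        (s.shift ν ∈ ⋃ i < N, (castSite '' Set.Icc (A i) (B i) : Set (Site P k))) →
          dist1 (holAt U' (walk (castSite c) (W s)) * U' ⟨s, ν⟩ * (holAt U' (walk (castSite c) (W (s.shift ν))))⁻¹)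
            ≤ max ((((2 * (P.d * (m + 1) + 1) + 1 : ℕ) : ℝ) ^ 2 / 4))
                (((P.d * (max m m + 1) : ℕ) : ℝ) * ((((2 * (P.d * (m + 1) + 1) + 1 : ℕ) : ℝ) ^ 2 / 4))
                  + ((2 * (P.d * (max m m + 1)) + 1 : ℕ) : ℝ) ^ 2 / 4) * ((12 * P.d * (n + 2) ^ 2 + 1) * ε) :=
    fun U' hU' => (treeOfBoxes_bondBound U' hε' hU' (castSite c) W A B hm hNi hmN rep hrep σ μ hσ [] hhA hhB hρ0 hW0 hS0 p hp f
      hfA hfB hfA' hfB' hNN hsep hWi htouch htouch' hSin hScross N).2.2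
  have hK : (0 : ℝ) ≤ max ((((2 * (P.d * (m + 1) + 1) + 1 : ℕ) : ℝ) ^ 2 / 4))
      (((P.d * (max m m + 1) : ℕ) : ℝ) * ((((2 * (P.d * (m + 1) + 1) + 1 : ℕ) : ℝ) ^ 2 / 4)) + ((2 * (P.d * (max m m + 1)) + 1 : ℕ) : ℝ) ^ 2 / 4) :=
    le_max_of_le_left (by positivity)
  have hρ' := hρ
  push_cast at hρ' hℓ
  exact exists_gauge_normalising_extend_of_bondBoundSystem_le hd hlohi hn hN hbox hZ hε hreg _ (castSite c) W
    (ℓ := P.d * (m + 1)) (fun x hx => hℓ x hx) hin hK hinv 𝒞 h𝒞 (by push_cast; exact hρ')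

/-- ★★★ **THE CUBE-TEMPLATE EDITION** of `exists_gauge_normalising_extend_of_boxTree_le`: the root point `c` and every entry `f i` NEAR-CENTRAL in the transverse directions of the
boxes they serve (`|2c_κ − (A 0 κ + B 0 κ)| ≤ 1` off `μ 0`; `|2(f i)_κ − (A i κ + B i κ)| ≤ 1` and `|2(f i)_κ − (A (p i) κ + B (p i) κ)| ≤ 1` off `μ i` — e.g. aligned equal cubes entered
through face-layer centres); then ONE located hypothesis per box suffices: `boxPlaqs (A i − 2) (B i + 4) ⊆ plaqsInside (pts k Z)` (the caller's collar inclusion).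
[cite: Balaban1989LargeFieldI, p.193, p.194 (sentence after (1.77)); Balaban1985Averaging, (19)-(20) p.21; Balaban1987RG1, (0.3) p.252] -/
theorem exists_gauge_normalising_extend_of_boxTree_central_le (hd : 3 ≤ P.d) (hlohi : lo ≤ hi) {n : ℕ}
    (hn : ∀ κ, hi κ ≤ lo κ + n) (hN : ∀ κ, hi κ - lo κ + 3 < (P.sitesPerDir k : ℤ)) {Z Λ : Set (Site P 0)}
    (hbox : pts k Λ = (castSite '' Set.Icc lo hi : Set (Site P k)))
    (hZ : (boxPlaqs (lo - 1) (hi + 1) : Set (Plaq P k)) ⊆ plaqsInside (pts k Z))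
    {ε : ℝ} (hε : 0 < ε) {V : GaugeField P k G} (hreg : PlaqSmallOn (plaqsInside (pts k (Z ∩ Λᶜ))) ε V)
    (A B : ℕ → Fin P.d → ℤ) (hA0 : A 0 = lo - 1) (hB0 : B 0 = hi + 1)
    {m : ℕ} (hm : ∀ i κ, B i κ ≤ A i κ + m) (hNi : ∀ i κ, B i κ - A i κ + 3 < (P.sitesPerDir k : ℤ))
    (hmN : 2 * (P.d * (m + 1) + 1) + 1 < P.sitesPerDir k)
    (rep : ℕ → Site P k → Fin P.d → ℤ)
    (hrep : ∀ i, ∀ x ∈ (castSite '' Set.Icc (A i) (B i) : Set (Site P k)), A i ≤ rep i x ∧ rep i x ≤ B i ∧ (castSite (rep i x) : Site P k) = x)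
    (σ : ℕ → Equiv.Perm (Fin P.d)) (μ : ℕ → Fin P.d) (hσ : ∀ i, ∃ rest, (List.finRange P.d).map (σ i) = μ i :: rest)
    {c : Fin P.d → ℤ} (hcA : A 0 ≤ c) (hcB : c ≤ B 0) (hccen : ∀ κ, κ ≠ μ 0 → |2 * c κ - (A 0 κ + B 0 κ)| ≤ 1)
    (p : ℕ → ℕ) (hp : ∀ i, 1 ≤ i → p i < i) (f : ℕ → Fin P.d → ℤ)
    (hfA : ∀ i, 1 ≤ i → A (p i) ≤ f i) (hfB : ∀ i, 1 ≤ i → f i ≤ B (p i))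
    (hfA' : ∀ i, 1 ≤ i → A i - 1 ≤ f i) (hfB' : ∀ i, 1 ≤ i → f i ≤ B i + 1)
    (hfcen : ∀ i, 1 ≤ i → ∀ κ, κ ≠ μ i → |2 * f i κ - (A i κ + B i κ)| ≤ 1 ∧ |2 * f i κ - (A (p i) κ + B (p i) κ)| ≤ 1)
    (hNN : ∀ i, 1 ≤ i → ∀ κ, max (B (p i) κ) (B i κ) + 1 - min (A (p i) κ) (A i κ) < (P.sitesPerDir k : ℤ))
    (hsep : ∀ i, 1 ≤ i → B (p i) (μ i) < A i (μ i) ∨ B i (μ i) < A (p i) (μ i))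
    (hdisj : ∀ i i', i ≠ i' → Disjoint (castSite '' Set.Icc (A i) (B i) : Set (Site P k)) (castSite '' Set.Icc (A i') (B i')))
    (htouch : ∀ i, 1 ≤ i → ∀ (s : Site P k) (ν : Fin P.d), (s ∈ ⋃ k' < i, (castSite '' Set.Icc (A k') (B k') : Set (Site P k))) →
      s.shift ν ∈ (castSite '' Set.Icc (A i) (B i) : Set (Site P k)) → s ∈ (castSite '' Set.Icc (A (p i)) (B (p i)) : Set (Site P k)))
    (htouch' : ∀ i, 1 ≤ i → ∀ (s : Site P k) (ν : Fin P.d), s ∈ (castSite '' Set.Icc (A i) (B i) : Set (Site P k)) →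
      (s.shift ν ∈ ⋃ k' < i, (castSite '' Set.Icc (A k') (B k') : Set (Site P k))) → s.shift ν ∈ (castSite '' Set.Icc (A (p i)) (B (p i)) : Set (Site P k)))
    (hS : ∀ i, (boxPlaqs (A i - 2) (B i + 4) : Set (Plaq P k)) ⊆ plaqsInside (pts k Z))
    (N : ℕ) (𝒞 : Set (PBond P k))
    (h𝒞 : ∀ b ∈ 𝒞, (b.src ∈ ⋃ i < N, (castSite '' Set.Icc (A i) (B i) : Set (Site P k))) ∧ (b.tgt ∈ ⋃ i < N, (castSite '' Set.Icc (A i) (B i) : Set (Site P k))))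
    {ρ : ℝ}
    (hρ : max ((((2 * (P.d * (m + 1) + 1) + 1 : ℕ) : ℝ) ^ 2 / 4))
              (((P.d * (max m m + 1) : ℕ) : ℝ) * ((((2 * (P.d * (m + 1) + 1) + 1 : ℕ) : ℝ) ^ 2 / 4))
                + ((2 * (P.d * (max m m + 1)) + 1 : ℕ) : ℝ) ^ 2 / 4) * ((12 * P.d * (n + 2) ^ 2 + 1) * ε)
          + (((P.d * (m + 1) : ℕ) : ℝ) + 1) * (3 * P.d * (n + 2) ^ 2 * ε) ≤ ρ) :
    ∃ u : GaugeTransf P k G, (∀ s ∈ pts k Λ, u s = 1) ∧ u (castSite (lo - 1)) = 1 ∧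
      ∀ b ∈ 𝒞, dist1 (GaugeField.gaugeAct u (extend (pts k Λ) (shellGauge V lo hi) V) b) ≤ ρ :=
  exists_gauge_normalising_extend_of_boxTree_le hd hlohi hn hN hbox hZ hε hreg A B hA0 hB0 hm hNi hmN rep hrep σ μ hσ hcA hcB
    ((sharpBox_subset_of_central hccen).trans (hS 0)) p hp f hfA hfB hfA' hfB' hNN hsep hdisj htouch htouch'
    (fun i hi => (sharpBox_subset_of_central fun κ hκ => (hfcen i hi κ hκ).1).trans (hS i))
    (fun i hi => (crossBox_subset_of_central (hfA i hi) (hfB i hi) fun κ hκ => (hfcen i hi κ hκ).2).trans (hS (p i))) N 𝒞 h𝒞 hρ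

end Literature.MathematicalPhysics.QuantumFieldTheory.Balaban1983to89.T4StairWordSystemCubeTreeProp1

end
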